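import Mathlib

/-! # PINNING of a critical point near a zero by a strong smooth field — Banach fixed-point route (Rouché-free)

C1 rh-idea-5 g26 (W-08 law421, crux 24774 SUCC side; pub file, not landed). `import Mathlib` only: `PinningSig` / `pinning` (abstract: a zero of
`1/(z − v) + M(z)` within `r` of `v` when `r‖M‖ ≥ 1` and `‖M′‖ ≤ θ‖M‖²`, `θ < 1`, on `D̄(v, r)`), `exists_deriv_eq_zero_near` (for `g = (z − v)·h`:
a zero `z ≠ v` of `g′` in `D̄(v, r)`), and (v2) the PAIR FORM `exists_deriv_eq_zero_near_pair` (for `g = (z − v)(z − v̄)·q`: hypotheses on the field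
`K = q′/q` of the OTHER zeros only — `‖K‖ ≥ 3/Im v`, `‖K′‖ ≤ 1/Im v²` on `D̄(v, Im v)` ⇒ a critical point `z ≠ v`, `‖z − v‖ ≤ Im v`). In W-08 words: `M = h′/h = 1/(z − v̄) + K` (K = field of all other zeros); with `r = Im v` the hypotheses
follow from `‖K‖ ≥ 3/Im v` and `‖K′‖ ≤ 1/Im v²` on `D̄(v, Im v)` (θ = 1/2) — the STRONG-FIELD regime that `RhW08.SuccTheft.blocked_at_scale` says the
non-Ready residual lives in (one-sided there; uniform here — the gap is the hands’). Nothing here bears on the truth of RH. -/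

open Complex Set Metric
open scoped ComplexConjugate

namespace RhW08.Pin

/-- ★ PINNING SIGNATURE: if `M` is holomorphic near the closed disc `D̄(v, r)`, nowhere zero there, STRONG (`r·‖M‖ ≥ 1`) and SMOOTH relative to its size
(`‖M′‖ ≤ θ‖M‖²`, `θ < 1`), then `1 + (z − v)·M(z)` has a zero in `D̄(v, r)` — i.e. `1/(z − v) + M(z)` vanishes at some `z ≠ v` within `r` of `v`. -/
def PinningSig : Prop :=
  ∀ (M : ℂ → ℂ) (v : ℂ) (r θ : ℝ), 0 < r → 0 ≤ θ → θ < 1 →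
    (∀ z ∈ closedBall v r, DifferentiableAt ℂ M z) → (∀ z ∈ closedBall v r, M z ≠ 0) →
    (∀ z ∈ closedBall v r, 1 ≤ r * ‖M z‖) → (∀ z ∈ closedBall v r, ‖deriv M z‖ ≤ θ * ‖M z‖ ^ 2) →
    ∃ z ∈ closedBall v r, 1 + (z - v) * M z = 0

/-- ★ PINNING holds: the fixed-point argument via Banach iteration on `z ↦ v − 1/M(z)`. -/
theorem pinning : PinningSig := by
  intro M v r θ hr hθ0 hθ1 hdiff hne hbig hsm
  set S : Set ℂ := closedBall v r with hS
  set Φ : ℂ → ℂ := fun z => v - (M z)⁻¹ with hΦ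
  -- self-map
  have hmaps : MapsTo Φ S S := by
    intro z hz
    have hz1 := hbig z hz
    have hMz : 0 < ‖M z‖ := norm_pos_iff.mpr (hne z hz)
    show Φ z ∈ closedBall v r
    rw [mem_closedBall, dist_eq_norm]
    have : Φ z - v = -(M z)⁻¹ := by simp [hΦ]
    rw [this, norm_neg, norm_inv]
    rw [inv_le_comm₀ hMz hr]
    calc r⁻¹ = r⁻¹ * 1 := by ring
      _ ≤ r⁻¹ * (r * ‖M z‖) := by gcongr
      _ = ‖M z‖ := by field_simp
  -- derivative bound for z ↦ (M z)⁻¹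
  have hdinv : ∀ z ∈ S, DifferentiableAt ℂ (fun w => (M w)⁻¹) z := fun z hz => (hdiff z hz).inv (hne z hz)
  have hbound : ∀ z ∈ S, ‖deriv (fun w => (M w)⁻¹) z‖ ≤ θ := by
    intro z hz
    have hMz : 0 < ‖M z‖ := norm_pos_iff.mpr (hne z hz)
    have hd : deriv (fun w => (M w)⁻¹) z = -deriv M z / (M z) ^ 2 :=
      ((hdiff z hz).hasDerivAt.inv (hne z hz)).deriv
    rw [hd, norm_div, norm_neg, norm_pow]
    rw [div_le_iff₀ (by positivity)]
    exact hsm z hz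
  have hconv : Convex ℝ S := convex_closedBall v r
  have hlip : ∀ z ∈ S, ∀ w ∈ S, ‖Φ z - Φ w‖ ≤ θ * ‖z - w‖ := by
    intro z hz w hw
    have h := hconv.norm_image_sub_le_of_norm_deriv_le hdinv hbound hw hz
    have : Φ z - Φ w = -((M z)⁻¹ - (M w)⁻¹) := by rw [hΦ]; ring
    rw [this, norm_neg]
    exact h
  -- Banach fixed point on the complete set S
  have hSc : IsComplete S := (isClosed_closedBall).isComplete
  set K : NNReal := ⟨θ, hθ0⟩ with hK
  have hcontr : ContractingWith K (hmaps.restrict Φ S S) := by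
    refine ⟨by exact_mod_cast hθ1, ?_⟩
    refine LipschitzWith.of_dist_le_mul fun x y => ?_
    simp only [Subtype.dist_eq, MapsTo.val_restrict_apply, dist_eq_norm]
    exact hlip x x.2 y y.2
  have hvS : v ∈ S := mem_closedBall_self hr.le
  obtain ⟨z, hzS, hfix, -⟩ := hcontr.exists_fixedPoint' hSc hmaps hvS (edist_ne_top _ _)
  refine ⟨z, hzS, ?_⟩
  have hz : Φ z = z := hfix
  have hMz : M z ≠ 0 := hne z hzS
  have hz' : v - (M z)⁻¹ = z := hz
  have : z - v = -(M z)⁻¹ := by linear_combination -hz'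
  rw [this]; field_simp; ring

/-- ★ CRITICAL POINT PINNED NEAR A ZERO: write an entire `g` as `g = (z − v)·h` with `h` entire (so `h = g/(z − v)`, carrying the conjugate factor
and every other zero); if the reduced log-derivative `M = h′/h` is STRONG (`r‖M‖ ≥ 1`) and SMOOTH (`‖M′‖ ≤ θ‖M‖²`, `θ < 1`) on the zero-free closed
disc `D̄(v, r)` of `h`, then `g′` has a zero `z ≠ v` in `D̄(v, r)` (because `g′ = h·(1 + (z − v)M)`). Rouché-free: Banach fixed point of `z ↦ v − 1/M(z)`. -/
theorem exists_deriv_eq_zero_near {g h : ℂ → ℂ} {v : ℂ} {r θ : ℝ} (hr : 0 < r) (hθ0 : 0 ≤ θ) (hθ1 : θ < 1)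
    (hg : ∀ z, g z = (z - v) * h z) (hh : Differentiable ℂ h) (hne : ∀ z ∈ closedBall v r, h z ≠ 0)
    (hbig : ∀ z ∈ closedBall v r, 1 ≤ r * ‖deriv h z / h z‖)
    (hsm : ∀ z ∈ closedBall v r, ‖deriv (fun w => deriv h w / h w) z‖ ≤ θ * ‖deriv h z / h z‖ ^ 2) :
    ∃ z ∈ closedBall v r, z ≠ v ∧ deriv g z = 0 := by
  have hh' : Differentiable ℂ (deriv h) := fun z => (hh.analyticAt z).deriv.differentiableAt
  have hM : ∀ z ∈ closedBall v r, DifferentiableAt ℂ (fun w => deriv h w / h w) z :=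
    fun z hz => (hh' z).div (hh z) (hne z hz)
  have hMne : ∀ z ∈ closedBall v r, deriv h z / h z ≠ 0 := by
    intro z hz h0
    have := hbig z hz
    rw [h0, norm_zero, mul_zero] at this
    exact absurd this (by norm_num)
  obtain ⟨z, hzS, hz⟩ := pinning (fun w => deriv h w / h w) v r θ hr hθ0 hθ1 hM hMne hbig hsm
  refine ⟨z, hzS, ?_, ?_⟩
  · rintro rfl
    simp at hz
  · have hgf : g = fun w => (w - v) * h w := funext hg
    have hd : deriv g z = 1 * h z + (z - v) * deriv h z := by
      rw [hgf]; exact (((hasDerivAt_id z).sub_const v).mul (hh z).hasDerivAt).deriv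
    rw [hd]
    have hz' : 1 + (z - v) * (deriv h z / h z) = 0 := hz
    have hne' := hne z hzS
    field_simp at hz'
    linear_combination hz'

/-! ## The conjugate-pair form: hypotheses on the field `K = q′/q` of the OTHER zeros only -/

/-- `‖z − v̄‖ ≥ Im v` on the closed disc `D̄(v, Im v)` (`Im v > 0`). -/
theorem im_le_norm_sub_conj {v z : ℂ} (hv : 0 < v.im) (hz : z ∈ closedBall v v.im) : v.im ≤ ‖z - conj v‖ := by
  rw [mem_closedBall, dist_eq_norm] at hz
  have h2 : ‖v - conj v‖ = 2 * v.im := by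
    have : v - conj v = ((2 * v.im : ℝ) : ℂ) * I := by
      apply Complex.ext <;> simp [two_mul]
    rw [this, norm_mul, Complex.norm_real, Complex.norm_I, mul_one, Real.norm_eq_abs, abs_of_pos (by linarith)]
  have htri : ‖v - conj v‖ ≤ ‖v - z‖ + ‖z - conj v‖ := by
    calc ‖v - conj v‖ = ‖(v - z) + (z - conj v)‖ := by congr 1; ring
      _ ≤ ‖v - z‖ + ‖z - conj v‖ := norm_add_le _ _
  rw [norm_sub_rev v z] at htri
  linarith

/-- ★★ PAIR FORM (the W-08 reading, constants `3/Im v` and `1/Im v²`, radius `Im v`, `θ = 1/2`): write an entire `g` as `g = (z − v)(z − v̄)·q` with `q`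
entire and zero-free on `D̄(v, Im v)`, and let `K = q′/q` be the field of ALL OTHER zeros. If `‖K‖ ≥ 3/Im v` (STRONG) and `‖K′‖ ≤ 1/Im v²` (SMOOTH) on
`D̄(v, Im v)`, then `g′` has a zero `z ≠ v` with `‖z − v‖ ≤ Im v`. (A far comb of `N` teeth at distance `L`: `K ≈ N/L`, `K′ ≈ K²/N`.) -/
theorem exists_deriv_eq_zero_near_pair {g q : ℂ → ℂ} {v : ℂ} (hv : 0 < v.im)
    (hg : ∀ z, g z = (z - v) * (z - conj v) * q z) (hq : Differentiable ℂ q) (hne : ∀ z ∈ closedBall v v.im, q z ≠ 0)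
    (hbig : ∀ z ∈ closedBall v v.im, 3 / v.im ≤ ‖deriv q z / q z‖)
    (hsm : ∀ z ∈ closedBall v v.im, ‖deriv (fun w => deriv q w / q w) z‖ ≤ 1 / v.im ^ 2) :
    ∃ z ∈ closedBall v v.im, z ≠ v ∧ deriv g z = 0 := by
  set h : ℂ → ℂ := fun z => (z - conj v) * q z with hh_def
  have hg' : ∀ z, g z = (z - v) * h z := fun z => by rw [hg z, hh_def]; ring
  have hh : Differentiable ℂ h := (differentiable_id.sub_const _).mul hq
  have hq' : Differentiable ℂ (deriv q) := fun z => (hq.analyticAt z).deriv.differentiableAt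
  -- the derivative of `h` and the splitting `h′/h = 1/(z − v̄) + q′/q`
  have hdh : ∀ w, deriv h w = q w + (w - conj v) * deriv q w := by
    intro w
    have hd : HasDerivAt (fun z : ℂ => (z - conj v) * q z) (1 * q w + (w - conj v) * deriv q w) w :=
      ((hasDerivAt_id' w).sub_const (conj v)).mul (hq w).hasDerivAt
    rw [hh_def, hd.deriv]; ring
  have hsplit : ∀ w, w ≠ conj v → q w ≠ 0 → deriv h w / h w = (w - conj v)⁻¹ + deriv q w / q w := by
    intro w hw hqw
    have hw' : w - conj v ≠ 0 := sub_ne_zero.mpr hw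
    rw [hdh w, hh_def]
    field_simp
    try ring
  -- facts on the disc
  have hconj_ne : ∀ z ∈ closedBall v v.im, z ≠ conj v := by
    intro z hz heq
    have := im_le_norm_sub_conj hv hz
    rw [heq, sub_self, norm_zero] at this
    linarith
  have hne_h : ∀ z ∈ closedBall v v.im, h z ≠ 0 := fun z hz => by
    rw [hh_def]; exact mul_ne_zero (sub_ne_zero.mpr (hconj_ne z hz)) (hne z hz)
  have hPle : ∀ z ∈ closedBall v v.im, ‖(z - conj v)⁻¹‖ ≤ 1 / v.im := by
    intro z hz
    rw [norm_inv, one_div]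
    exact inv_anti₀ hv (im_le_norm_sub_conj hv hz)
  -- STRONG: `Im v · ‖M‖ ≥ 1` (indeed ≥ 2)
  have hM2 : ∀ z ∈ closedBall v v.im, 2 / v.im ≤ ‖deriv h z / h z‖ := by
    intro z hz
    rw [hsplit z (hconj_ne z hz) (hne z hz)]
    have h1 := hPle z hz
    have h3 := hbig z hz
    have htri : ‖deriv q z / q z‖ ≤ ‖(z - conj v)⁻¹ + deriv q z / q z‖ + ‖(z - conj v)⁻¹‖ := by
      calc ‖deriv q z / q z‖ = ‖((z - conj v)⁻¹ + deriv q z / q z) - (z - conj v)⁻¹‖ := by congr 1; ring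
        _ ≤ ‖(z - conj v)⁻¹ + deriv q z / q z‖ + ‖(z - conj v)⁻¹‖ := norm_sub_le _ _
    have : 3 / v.im - 1 / v.im = 2 / v.im := by ring
    linarith
  have hbigM : ∀ z ∈ closedBall v v.im, 1 ≤ v.im * ‖deriv h z / h z‖ := by
    intro z hz
    have := hM2 z hz
    rw [div_le_iff₀ hv] at this
    linarith
  -- SMOOTH: `‖M′‖ ≤ ½‖M‖²`
  have hsmM : ∀ z ∈ closedBall v v.im, ‖deriv (fun w => deriv h w / h w) z‖ ≤ 1 / 2 * ‖deriv h z / h z‖ ^ 2 := by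
    intro z hz
    have hzc := hconj_ne z hz
    have hqz := hne z hz
    -- `M` agrees with `P + K` near `z`
    have hU : IsOpen {w : ℂ | q w ≠ 0 ∧ w ≠ conj v} :=
      (hq.continuous.isOpen_preimage {0}ᶜ isOpen_compl_singleton).inter isOpen_ne
    have hev : (fun w => deriv h w / h w) =ᶠ[nhds z] (fun w => (w - conj v)⁻¹ + deriv q w / q w) :=
      Filter.eventually_of_mem (hU.mem_nhds ⟨hqz, hzc⟩) (fun w hw => hsplit w hw.2 hw.1)
    rw [hev.deriv_eq]
    have hPd : HasDerivAt (fun w : ℂ => (w - conj v)⁻¹) (-(1 : ℂ) / (z - conj v) ^ 2) z :=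
      ((hasDerivAt_id z).sub_const (conj v)).inv (sub_ne_zero.mpr hzc)
    have hKd : DifferentiableAt ℂ (fun w => deriv q w / q w) z := (hq' z).div (hq z) hqz
    have hsumd : HasDerivAt (fun w => (w - conj v)⁻¹ + deriv q w / q w)
        (-(1 : ℂ) / (z - conj v) ^ 2 + deriv (fun w => deriv q w / q w) z) z := hPd.add hKd.hasDerivAt
    rw [hsumd.deriv]
    have hn1 : ‖-(1 : ℂ) / (z - conj v) ^ 2‖ ≤ 1 / v.im ^ 2 := by
      rw [norm_div, norm_neg, norm_one, norm_pow]
      have := im_le_norm_sub_conj hv hz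
      exact one_div_le_one_div_of_le (by positivity) (pow_le_pow_left₀ hv.le this 2)
    have hn2 := hsm z hz
    have hsum : ‖-(1 : ℂ) / (z - conj v) ^ 2 + deriv (fun w => deriv q w / q w) z‖ ≤ 2 / v.im ^ 2 := by
      have := norm_add_le (-(1 : ℂ) / (z - conj v) ^ 2) (deriv (fun w => deriv q w / q w) z)
      have e : 1 / v.im ^ 2 + 1 / v.im ^ 2 = 2 / v.im ^ 2 := by ring
      linarith
    have hM := hM2 z hz
    have hM0 : 0 ≤ 2 / v.im := by positivity
    have hsq : (2 / v.im) ^ 2 ≤ ‖deriv h z / h z‖ ^ 2 := pow_le_pow_left₀ hM0 hM 2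
    have e2 : (2 / v.im) ^ 2 = 2 * (2 / v.im ^ 2) := by ring
    nlinarith
  exact exists_deriv_eq_zero_near hv (by norm_num) (by norm_num) hg' hh hne_h hbigM hsmM

end RhW08.Pin
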